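import Literature.MathematicalPhysics.QuantumFieldTheory.Balaban1983to89.B9GradViaDivLettersPrintWeight
import Literature.MathematicalPhysics.QuantumFieldTheory.Balaban1983to89.B9PerturbationMajorantAlgebra

/-!
# `Balaban1983to89.B9SmoothHolderClassPProducers` — PRODUCERS INTO THE PRINT-WEIGHTED GRADED SITE CLASS `bHZPG (U(Γ)) w` ALONG PRINT'S ROUTE
# «Theorem 3.1 and the inequality (3.49)» (p. 421): the LIPSCHITZ words `G′∘Z`, `P∘X` by the covariant telescope from their sup and sup-gradient
# members ((3.42)₁,₂, (3.49)₁,₂), the words through `R = ϱ(I − P)` by difference, and the words `RG′∇\*_U∘Y` from ONE (3.43) member for `G′∇\*_U`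

T. Bałaban, *Propagators for lattice gauge theories in a background field*, Commun. Math. Phys. **99** (1985) 389–434
[`Balaban1985BackgroundPropagators`, "B9"]; [4] = T. Bałaban, *Propagators and renormalization transformations for lattice gauge
theories. II*, Commun. Math. Phys. **96** (1984) 223–250 [`Balaban1984PropagatorsII`].

statement-level skeleton of published theorems with citation tags; proofs where landed; nothing here is a claim about the
Yang–Mills mass gap

THE PRINTED LOCI (held text `paper:balaban1985-cmp99-background-propagators`, pp. 397–399, 421–423 re-read first-hand).  Thm 3.1 (3.42) p. 397:
*"|(G′(U)λ)(x)|, |(∇_UG′(U)λ)(x)|, |(G′(U)∇\*_Uλ)(x)| ≦ B₀{(Lʲη)², Lʲη, Lʲη}e^{−δ₀d(y,y′)}|λ|"*; (3.43) p. 398: *"‖ζ∇_UG′(U)λ‖_β, ‖ζG′(U)∇\*_Uλ‖_β ≦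
B₀(β)(Lʲη)^{1−β}(‖ζ‖_β + |ζ|)e^{−δ₀d(y,y′)}|λ|"*; (3.49) p. 399: *"|P(x,x′)|, |(∇_UP)(x,x′)|, |(P∇\*_U)(x,x′)| ≦ O(1){1, (Lʲη)⁻¹, (Lʲη)⁻¹}(L^{j′}η)^{−d}
e^{−½δ₀d(y,y′)}"* (P = I − R); p. 421: *"It is easy to find estimates for the operator Δ′_π using Theorem 3.1 and the inequality (3.49), we have to be
careful only with the third term in the definition (3.120) of Δ′_π.  One of the three derivatives there has to be applied either to an expression on the
right, or on the left, of Δ′_π"*; p. 423: *"we have derivatives in the operator Δ′_π + Δ⁽²⁾ which have to be applied either to the operator on the right,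
or on the left, because kernels of the operators defining Δ′_π + Δ⁽²⁾ are not regular enough"*; (3.40) p. 397 (the transported Hölder quotient along
the shortest contour Γ_{x,x′}); [4] (2.51)–(2.56) pp. 232–233, Lemma 2.1 (2.60)–(2.61) p. 234.

WHY THIS FILE (cell `pub-ymgap`, node N06, seat dag-n06-l g25; LOCATED-U7 of the seat's bus note 2026-08-29).  The N06 certificate of record (dag-n06-d
ED.64) displays three PRODUCERS INTO the rows-20–21 Hölder intermediate `bH13 x U := bHZPG (taxiS U) w13` (print-weighted graded transported site class,
`B9SmoothHolderClassP`): `Letters313DZ.rgdH` (`R∇\*_UG₁ = RG′∇\*_U`, (3.152)) and `Letters3131H.tbH ∕ tb₂H` (the parts `T_b = RG′B† − RG′D\*BG′RD\*`,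
`T_b₂ = −RG′D\*Δ⁽²⁾π` of Δ′_π, Δ⁽²⁾_π under the moved derivative).  The covariant telescope `B9GradViaDivLettersPrintWeight.hasMaj_into_bHZPG_of_grad`
(g24) produces such members from a sup member AND a sup member of the covariant GRADIENT — but `D_U∘RG′∇\*_U` is the order-zero word ∇G′∇\* which print
bounds only with a HÖLDER input ((3.44)), never sup→sup (p. 423: «kernels … not regular enough»): for these three producers the gradient word is NOT a
printed species (LOCATED-U7).  PRINT'S ROUTE (p. 421) is Theorem 3.1 — INCLUDING its Hölder entry (3.43) for `G′∇\*_U` — and (3.49): writing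
`R = ϱ(I − P)`, every producer is `ϱ·(W − P∘W)` with `W` either a LIPSCHITZ word `G′∘Z` (sup (3.42)₁ AND sup-gradient (3.42)₂ — the telescope applies
honestly) or the genuinely Hölder word `G′∇\*_U∘Y` ((3.43), ONE displayed member), and `P∘W` is Lipschitz at scale Lʲη ((3.49)₁,₂ — telescope again).
THIS FILE is that algebra, for ANY source class `b₁`, at the block maps of the certificate's pins (`blkSK (sIK bI)` sites, `blkBK bI` bonds) and
def-Y's gradient model `DvcoKH`:
* §1 `CTel` (the telescope's constant, named; `_nonneg ∕ _mono ∕ _mul`), `hasMaj_src_ofR ∕ _toR` (integer vs real source weights, any target), `hasMaj_id_cNormR`;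
* §2 ★ `hasMaj_Gp_comp_sup ∕ _grad ∕ _into_bHZPG` — `G′∘Z : b₁ → bHZPG` from `Z : b₁ → 𝔠_W^{(1)}` and the (3.42)₁,₂ class words of G′;
* §3 ★ `hasMaj_P_comp_into_bHZPG` — `P∘X : b₁ → bHZPG` from `X : b₁ → 𝔠_W^{(−1)}` and the (3.49)₁,₂ class words of P;
* §4 ★★ `hasMaj_R_Gp_comp_into_bHZPG` — `RG′∘Z` (R = ϱ(I − P); the scalar is pushed onto `Z`, no homogeneity of the Hölder size is used);
* §5 ★★★ `hasMaj_R_GpDvs_comp_into_bHZPG` — `RG′∇\*_U∘Y : b₁ → bHZPG` from `Y : b₁ → 𝔠⁽⁰⁾`, the (3.42)₃ class word AND ONE (3.43) member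
  `h43 : HasMaj 𝔠⁽⁰⁾ (bHZPG (taxiS U) w) (G′ ∘ D\*_U) (B₄₃e^{−r₄₃d})` of G′; ★★ `hasMaj_R_GpDvs_into_bHZPG` (`Y = I`: the producer `rgdH` after (3.152)).
The consumers at def-Y's pinned letters (`rgdH`, `tbH`, `tb₂H`, `Letters3131H`) are the sequel `B9Thm313WholeHolderProducersAtPinsPrint`.
HONEST SCOPE.  Bookkeeping over landed objects ([4] (2.52)–(2.56), (2.60)–(2.61) as typed in `B9PerturbationMajorantAlgebra`; the telescope of g24); Theorem 3.1
((3.42), (3.43)), (3.49) and the member facts enter as HYPOTHESES of printed species — nothing of [B9]∕[4] is asserted; the constants (`CTel`, products of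
`B₀, C_P, c, L, |ϱ|`) are ours and not optimised; no pin, no certificate edit; COUNT-NEUTRAL; N06 NOT discharged; one finite torus at a time — nothing
continuum, nothing about OS positivity or the mass gap.  Cell `pub-ymgap` (HUMAN RULING D-0062), Track A node N06 [B9], seat `pub-ymgap-dag-n06-l` (g25), 2026-08-29.
-/

noncomputable section

namespace Literature.MathematicalPhysics.QuantumFieldTheory.Balaban1983to89.B9SmoothHolderClassPProducers

open B6Geom246MultiLevelTorus (geomT)
open B6GlobalChartV1 (PV blkV1)
open B6Ineq2142KLevelV1 (β lvl)
open B6KLevelCensusIndexV1 (KIdx)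
open B6Prop22KLevelTorusCensusEta (nKT)
open B9GeoNormsKLevelV1 (geo9K)
open B9GeoLemma21KLevelV1 (geo9K_len_pos geo9K_dist_self)
open B9Thm34Ext (toB6)
open B9Thm39ReadingCoords (coordBound39 basisBound39)
open B9Thm312Whole (GeoOK cNorm)
open B9Thm312WholeClasses (cNormR cNormR_loc cNormR_loc_neg_natCast)
open B9RWSums343to347Whole (Facts347)
open B11SectG (BlockNorm HasMaj RowSum)
open B9CoReadingCoords (XBK blkBK)
open B9CoReadingCoordsS (XSK sIK blkSK)
open B9GradViaDivLettersTransported (taxiS)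
open B9MultiscaleSmoothPartitionYNear (rNear)
open B9SmoothHolderClassP (bHZPG)
open B9GradViaDivLettersPrintWeight (hasMaj_into_bHZPG_of_grad)
open B9PerturbationMajorantAlgebra (hasMaj_shift hasMaj_comp_cNormR hasMaj_weaken hasMaj_sub_exp hasMaj_smul_exp rpow_abs_eq_pow)
open Node00 (SiteY FBondY IBondY CfgY toKT)
open Node00.OpsYSectDCoords (DvcoKH)
open T4RelativeLadder (UnitaryLike)

variable {d ℓ : ℕ} {hd : 1 ≤ d + 1} {hL : Odd (ℓ + 1) ∧ 1 < ℓ + 1} {b₀ b₁ : ℝ}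
variable {𝔸 : Type} [NormedRing 𝔸] [NormedAlgebra ℂ 𝔸] [CompleteSpace 𝔸] [FiniteDimensional ℝ 𝔸]
variable {κ : Type} [Fintype κ]
variable (i : KIdx d ℓ hd hL b₀ b₁) [Fintype (geo9K i).Site] (b : Module.Basis κ ℝ 𝔸)

/-! ## §1 The telescope's constant, named; the identity on a state class -/

/-- the constant of the covariant telescope INTO `bHZPG` (`B9GradViaDivLettersPrintWeight.hasMaj_into_bHZPG_of_grad`, verbatim): from a sup member of size `C₀` and a
sup-gradient member of size `C₁`, both at the rate `δ`, the member INTO the class has size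
`L·(C₀e^{δ(r_near+1)} + (d+1)·(coordBound·Σ‖b_c‖)·C₁·e^{δ(r_near + 2(d+1)L² + 2)})`. [cite: Balaban1985BackgroundPropagators, (3.43) p.398 (bookkeeping); Balaban1984PropagatorsII, (2.51)–(2.54) pp.232–233] -/
def CTel (d ℓ : ℕ) (b : Module.Basis κ ℝ 𝔸) (δ C₀ C₁ : ℝ) : ℝ :=
  (((ℓ + 1 : ℕ) : ℝ)) * (C₀ * Real.exp (δ * (rNear d ℓ + 1)) +
    (((d : ℝ) + 1) * (coordBound39 b * basisBound39 b)) * C₁ * Real.exp (δ * (rNear d ℓ + (2 * ((d : ℝ) + 1) * (((ℓ + 1 : ℕ) : ℝ)) ^ 2 + 2))))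

omit [CompleteSpace 𝔸] in
/-- `0 ≤ CTel` for non-negative sizes. [cite: Balaban1985BackgroundPropagators, (3.43) p.398 (bookkeeping)] -/
theorem CTel_nonneg {δ C₀ C₁ : ℝ} (hC₀ : 0 ≤ C₀) (hC₁ : 0 ≤ C₁) : 0 ≤ CTel d ℓ b δ C₀ C₁ := by
  unfold CTel
  have : 0 ≤ coordBound39 b * basisBound39 b := mul_nonneg (norm_nonneg _) (Finset.sum_nonneg fun _ _ => norm_nonneg _)
  positivity

omit [CompleteSpace 𝔸] in
/-- `CTel` is monotone in the two sizes. [cite: Balaban1985BackgroundPropagators, (3.43) p.398 (bookkeeping)] -/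
theorem CTel_mono {δ C₀ C₁ C₀' C₁' : ℝ} (h₀ : C₀ ≤ C₀') (h₁ : C₁ ≤ C₁') : CTel d ℓ b δ C₀ C₁ ≤ CTel d ℓ b δ C₀' C₁' := by
  unfold CTel
  have hL : 0 ≤ (((ℓ + 1 : ℕ) : ℝ)) := by positivity
  have hcb : 0 ≤ ((d : ℝ) + 1) * (coordBound39 b * basisBound39 b) :=
    mul_nonneg (by positivity) (mul_nonneg (norm_nonneg _) (Finset.sum_nonneg fun _ _ => norm_nonneg _))
  refine mul_le_mul_of_nonneg_left (add_le_add (mul_le_mul_of_nonneg_right h₀ (Real.exp_nonneg _)) ?_) hL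
  exact mul_le_mul_of_nonneg_right (mul_le_mul_of_nonneg_left h₁ hcb) (Real.exp_nonneg _)

omit [CompleteSpace 𝔸] in
/-- `CTel` is linear in the two sizes: a common factor (the certificate's smallness `θ = Mα₀`) comes out. [cite: Balaban1985BackgroundPropagators, (3.131) p.422 (bookkeeping)] -/
theorem CTel_mul (δ C₀ C₁ t : ℝ) : CTel d ℓ b δ (C₀ * t) (C₁ * t) = CTel d ℓ b δ C₀ C₁ * t := by
  unfold CTel
  ring

section SourceBridge

variable {g : B9.Geometry} [Fintype g.Site] {R₀ : ℝ} {H₀ : Prop} {V : Type} [Fintype V]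
variable {F₂ : Type} [AddCommGroup F₂] [Module ℝ F₂]

/-- a majorant out of `𝔠_V^{(−q)}` (real weight) into ANY block norm is the same majorant out of the integer-weight state norm `cNorm … q` (the two source sizes
agree on positive lengths, the localisation predicates coincide). [cite: Balaban1985BackgroundPropagators, (3.42) p.397 (bookkeeping)] -/
theorem hasMaj_src_ofR (hG : GeoOK g) {blkV : V → g.Site} {N : BlockNorm (toB6 g R₀ H₀) F₂} {T : (V → ℝ) →ₗ[ℝ] F₂} {K : g.Site → g.Site → ℝ} {q : ℕ}
    (h : HasMaj (cNormR R₀ H₀ blkV hG.lenle (-(q : ℝ))) N T K) : HasMaj (cNorm R₀ H₀ blkV hG.lenle q) N T K := by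
  intro y' μ hμ y
  rw [← cNormR_loc_neg_natCast hG]
  exact h y' μ hμ y

/-- converse of `hasMaj_src_ofR`: out of `cNorm … q` into any block norm ⟹ out of `𝔠_V^{(−q)}`. [cite: Balaban1985BackgroundPropagators, (3.42) p.397 (bookkeeping)] -/
theorem hasMaj_src_toR (hG : GeoOK g) {blkV : V → g.Site} {N : BlockNorm (toB6 g R₀ H₀) F₂} {T : (V → ℝ) →ₗ[ℝ] F₂} {K : g.Site → g.Site → ℝ} {q : ℕ}
    (h : HasMaj (cNorm R₀ H₀ blkV hG.lenle q) N T K) : HasMaj (cNormR R₀ H₀ blkV hG.lenle (-(q : ℝ))) N T K := by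
  intro y' μ hμ y
  rw [cNormR_loc_neg_natCast hG]
  exact h y' μ hμ y

end SourceBridge

section Identity

variable {R₀ : ℝ} {H₀ : Prop} {X : Type} [Fintype X]

/-- **the identity on a state class `𝔠^{(s)}` has the majorant `1·e^{−ρd}`** (a function vanishing off the block of `y′` has size 0 near every other block;
`d(y,y) = 0`). [cite: Balaban1984PropagatorsII, (2.51) p.232, (2.46) p.231] -/
theorem hasMaj_id_cNormR (hG : GeoOK (geo9K i)) (blk : X → (geo9K i).Site) (s ρ : ℝ) :
    HasMaj (cNormR R₀ H₀ blk hG.lenle s) (cNormR R₀ H₀ blk hG.lenle s) (LinearMap.id : (X → ℝ) →ₗ[ℝ] (X → ℝ))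
      (fun a a' => 1 * Real.exp (-(ρ * (geo9K i).dist a a'))) := by
  classical
  intro y' μ hμ y
  dsimp only
  rw [LinearMap.id_apply, cNormR_loc, cNormR_loc]
  by_cases hy : y = y'
  · subst hy
    rw [show (geo9K i).dist y y = 0 from geo9K_dist_self i y, mul_zero, neg_zero, Real.exp_zero, one_mul, one_mul]
  · -- μ vanishes off the block of y′, so its sharp-block sup size at y ≠ y′ is 0
    have h0 : (BlockNorm.ofBlocks (toB6 (geo9K i) R₀ H₀) blk).loc y μ = 0 := by
      show (⨆ x : X, if blk x = y then |μ x| else 0) = 0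
      by_cases hX : Nonempty X
      · refine le_antisymm (ciSup_le fun x => ?_) ?_
        · by_cases hx : blk x = y
          · have : μ x = 0 := hμ x (by rw [hx]; exact hy)
            simp [hx, this]
          · simp [hx]
        · exact le_ciSup_of_le (Finite.bddAbove_range _) (Classical.arbitrary X) (by split_ifs <;> simp [abs_nonneg])
      · rw [not_nonempty_iff] at hX
        simp [iSup_of_empty']
    rw [h0, mul_zero]
    exact mul_nonneg (mul_nonneg zero_le_one (Real.exp_nonneg _))
      (mul_nonneg (Real.rpow_nonneg (hG.lenle y') s) ((BlockNorm.ofBlocks (toB6 (geo9K i) R₀ H₀) blk).loc_nonneg y' μ))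

end Identity

/-! ## §2 ★ The Lipschitz word `G′∘Z` INTO the class: (3.42)₁ is the sup member, (3.42)₂ the sup-gradient member -/

section Producers

variable (B : B9.Backgrounds) (cfg : B.Cfg → CfgY 𝔸 i) {R₀ : ℝ} {H₀ : Prop} {bI : FBondY i → IBondY i}
variable {F₁ : Type} [AddCommGroup F₁] [Module ℝ F₁]
variable {dF : ℕ} {δF α L₀ σ c : ℝ}

/-- ★ the SUP member of `G′∘Z`: `Z : b₁ → 𝔠_W^{(1)}` (size `C_Z`, rate `ρ_Z`) followed by G′ ((3.42)₁ read `𝔠_W^{(0)} → 𝔠_W^{(−2)}`, shifted by one power of Lʲη at the cost `L·e^{αδ_F d}` of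
[4] (2.60)) is `G′∘Z : b₁ → 𝔠_W^{(−1)}` with size `B₀·L·C_Z·c` at any rate `ρ ≥ 0`, `ρ ≤ ρ_Z`, `ρ + σ + αδ_F ≤ r`.
[cite: Balaban1985BackgroundPropagators, Thm 3.1 (3.42) p.397 + p.398 (transfer remark) + p.421; Balaban1984PropagatorsII, (2.54), (2.60)–(2.61) pp.233–234] -/
theorem hasMaj_Gp_comp_sup (hG : GeoOK (geo9K i)) (hF : Facts347 (geo9K i) R₀ H₀ dF δF α L₀) (hrow : RowSum (toB6 (geo9K i) R₀ H₀) σ c)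
    {blkW : XSK κ i → (geo9K i).Site} {Gp : Module.End ℝ (XSK κ i → ℝ)} {b₁ : BlockNorm (toB6 (geo9K i) R₀ H₀) F₁} {Z : F₁ →ₗ[ℝ] (XSK κ i → ℝ)}
    {B₀ r CZ ρZ ρ : ℝ} (hB₀ : 0 ≤ B₀) (hCZ : 0 ≤ CZ) (hρ : 0 ≤ ρ) (hρZ : ρ ≤ ρZ) (hbud : ρ + σ + α * δF ≤ r)
    (hGp : HasMaj (cNormR R₀ H₀ blkW hG.lenle 0) (cNormR R₀ H₀ blkW hG.lenle (-2)) Gp (fun a a' => B₀ * Real.exp (-(r * (geo9K i).dist a a'))))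
    (hZ : HasMaj b₁ (cNormR R₀ H₀ blkW hG.lenle 1) Z (fun a a' => CZ * Real.exp (-(ρZ * (geo9K i).dist a a')))) :
    HasMaj b₁ (cNormR R₀ H₀ blkW hG.lenle (-1)) (Gp ∘ₗ Z) (fun a a' => B₀ * (geo9K i).L * CZ * c * Real.exp (-(ρ * (geo9K i).dist a a'))) := by
  have hGp' := hasMaj_shift hG hF (1 : ℝ) (by norm_num) hB₀ hGp
  rw [rpow_abs_eq_pow (geo9K i).L 1 1 (by norm_num), pow_one, show (0 : ℝ) + 1 = 1 by norm_num, show (-2 : ℝ) + 1 = -1 by norm_num] at hGp'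
  exact hasMaj_comp_cNormR hG hrow (mul_nonneg hB₀ (le_trans zero_le_one hF.one_le_L)) hCZ hρ hρZ (show ρ + σ ≤ r - α * δF by linarith) hGp' hZ

/-- ★ the SUP-GRADIENT member of `G′∘Z`: (3.42)₂ read `D_UG′ : 𝔠_W^{(0)} → 𝔠^{(−1)}`, shifted by one power, after `Z : b₁ → 𝔠_W^{(1)}`: `D_UG′∘Z : b₁ → 𝔠⁽⁰⁾`, size `B₀·L·C_Z·c`.
[cite: Balaban1985BackgroundPropagators, Thm 3.1 (3.42) p.397 + p.398 (transfer remark) + p.421; Balaban1984PropagatorsII, (2.54), (2.60)–(2.61) pp.233–234] -/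
theorem hasMaj_Gp_comp_grad (hG : GeoOK (geo9K i)) (hF : Facts347 (geo9K i) R₀ H₀ dF δF α L₀) (hrow : RowSum (toB6 (geo9K i) R₀ H₀) σ c)
    {blkW : XSK κ i → (geo9K i).Site} {blk : XBK κ i → (geo9K i).Site} {Gp : Module.End ℝ (XSK κ i → ℝ)} {Dv : (XSK κ i → ℝ) →ₗ[ℝ] (XBK κ i → ℝ)}
    {b₁ : BlockNorm (toB6 (geo9K i) R₀ H₀) F₁} {Z : F₁ →ₗ[ℝ] (XSK κ i → ℝ)}
    {B₀ r CZ ρZ ρ : ℝ} (hB₀ : 0 ≤ B₀) (hCZ : 0 ≤ CZ) (hρ : 0 ≤ ρ) (hρZ : ρ ≤ ρZ) (hbud : ρ + σ + α * δF ≤ r)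
    (hDvGp : HasMaj (cNormR R₀ H₀ blkW hG.lenle 0) (cNormR R₀ H₀ blk hG.lenle (-1)) (Dv ∘ₗ Gp)
      (fun a a' => B₀ * Real.exp (-(r * (geo9K i).dist a a'))))
    (hZ : HasMaj b₁ (cNormR R₀ H₀ blkW hG.lenle 1) Z (fun a a' => CZ * Real.exp (-(ρZ * (geo9K i).dist a a')))) :
    HasMaj b₁ (cNormR R₀ H₀ blk hG.lenle 0) (Dv ∘ₗ Gp ∘ₗ Z) (fun a a' => B₀ * (geo9K i).L * CZ * c * Real.exp (-(ρ * (geo9K i).dist a a'))) := by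
  have hD' := hasMaj_shift hG hF (1 : ℝ) (by norm_num) hB₀ hDvGp
  rw [rpow_abs_eq_pow (geo9K i).L 1 1 (by norm_num), pow_one, show (0 : ℝ) + 1 = 1 by norm_num, show (-1 : ℝ) + 1 = 0 by norm_num] at hD'
  exact (hasMaj_comp_cNormR hG hrow (mul_nonneg hB₀ (le_trans zero_le_one hF.one_le_L)) hCZ hρ hρZ (show ρ + σ ≤ r - α * δF by linarith)
    hD' hZ).congr fun μ => rfl

variable (w : ℝ → ℝ) (hw0 : ∀ s, 0 ≤ w s) (hw1 : ∀ s, w s ≤ 1)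

/-- ★ **THE LIPSCHITZ WORD `G′∘Z` INTO THE CLASS.**  `Z : b₁ → 𝔠_W^{(1)}` (size `C_Z`, rate `ρ_Z`), G′ with its (3.42)₁ sup word and (3.42)₂ sup-gradient word
(sizes `B₀`, rate `r`; the gradient model `DvcoKH` of the pins) ⟹ `G′∘Z : b₁ → bHZPG (taxiS U) w` with size `CTel ρ K K`, `K = B₀·L·C_Z·c`, at any rate `0 ≤ ρ ≤ ρ_Z`,
`ρ + σ + αδ_F ≤ r` — the covariant telescope (print p. 423's mean-value step) applied to the Lipschitz function `G′(Zμ)`.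
[cite: Balaban1985BackgroundPropagators, Thm 3.1 (3.42) p.397 + (3.40) p.397 + p.421 + p.423; Balaban1984PropagatorsII, (2.51)–(2.54), (2.60)–(2.61) pp.232–234] -/
theorem hasMaj_Gp_comp_into_bHZPG (hG : GeoOK (geo9K i)) (hF : Facts347 (geo9K i) R₀ H₀ dF δF α L₀) (hrow : RowSum (toB6 (geo9K i) R₀ H₀) σ c)
    (hβ1 : ∀ f : FBondY i, (geomT i.D).dist (β i.hN i.D i.hk (bI f)) (blkV1 i.hN i.D f) ≤ 1)
    (hlev : ∀ f : FBondY i, lvl i.hN i.D i.hk (bI f) = (blkV1 i.hN i.D f).1.1)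
    (hcf : |i.cf| = (nKT (toKT i) : ℝ)) {U : B.Cfg} (hU : ∀ ν x, UnitaryLike (cfg U ν x))
    {Gp : Module.End ℝ (XSK κ i → ℝ)} {b₁ : BlockNorm (toB6 (geo9K i) R₀ H₀) F₁} {Z : F₁ →ₗ[ℝ] (XSK κ i → ℝ)}
    {B₀ r CZ ρZ ρ : ℝ} (hB₀ : 0 ≤ B₀) (hCZ : 0 ≤ CZ) (hc : 0 ≤ c) (hρ : 0 ≤ ρ) (hρZ : ρ ≤ ρZ) (hbud : ρ + σ + α * δF ≤ r)
    (hGp : HasMaj (cNormR R₀ H₀ (blkSK i (sIK i bI)) hG.lenle 0) (cNormR R₀ H₀ (blkSK i (sIK i bI)) hG.lenle (-2)) Gp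
      (fun a a' => B₀ * Real.exp (-(r * (geo9K i).dist a a'))))
    (hDvGp : HasMaj (cNormR R₀ H₀ (blkSK i (sIK i bI)) hG.lenle 0) (cNormR R₀ H₀ (blkBK i bI) hG.lenle (-1)) (DvcoKH i b B cfg U ∘ₗ Gp)
      (fun a a' => B₀ * Real.exp (-(r * (geo9K i).dist a a'))))
    (hZ : HasMaj b₁ (cNormR R₀ H₀ (blkSK i (sIK i bI)) hG.lenle 1) Z (fun a a' => CZ * Real.exp (-(ρZ * (geo9K i).dist a a')))) :
    HasMaj b₁ (bHZPG (κ := κ) i b (taxiS i B cfg U) (R := R₀) (H := H₀) w hw0 hw1) (Gp ∘ₗ Z)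
      (fun a a' => CTel d ℓ b ρ (B₀ * (geo9K i).L * CZ * c) (B₀ * (geo9K i).L * CZ * c) * Real.exp (-(ρ * (geo9K i).dist a a'))) := by
  have hK : 0 ≤ B₀ * (geo9K i).L * CZ * c := mul_nonneg (mul_nonneg (mul_nonneg hB₀ (le_trans zero_le_one hF.one_le_L)) hCZ) hc
  have hsup := hasMaj_Gp_comp_sup i hG hF hrow hB₀ hCZ hρ hρZ hbud hGp hZ
  have hgrad := hasMaj_Gp_comp_grad i hG hF hrow hB₀ hCZ hρ hρZ hbud hDvGp hZ
  exact hasMaj_into_bHZPG_of_grad i b B cfg hG.lenle w hw0 hw1 hβ1 hlev hρ hcf hU hK hK hsup hgrad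

/-! ## §3 ★ The Lipschitz word `P∘X` INTO the class: (3.49)₁ is the sup member, (3.49)₂ the sup-gradient member -/

/-- ★ **THE LIPSCHITZ WORD `P∘X` INTO THE CLASS.**  `X : b₁ → 𝔠_W^{(−1)}` (size `C_X`, rate `ρ_X`), P = I − R with its (3.49)₁ sup word (`𝔠_W^{(0)} → 𝔠_W^{(0)}`) and
(3.49)₂ sup-gradient word (`D_UP : 𝔠_W^{(0)} → 𝔠^{(1)}`, i.e. `|D_UPμ| ≤ C_P(Lʲη)⁻¹|μ|`), sizes `C_P`, rate `r` ⟹ `P∘X : b₁ → bHZPG (taxiS U) w` with size `CTel ρ K K`,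
`K = C_P·L·C_X·c` — the kernel of P is smooth at the scale Lʲη, so `P(Xμ)` is Lipschitz with the dimensionless gradient bound and the telescope applies.
[cite: Balaban1985BackgroundPropagators, (3.49) p.399 + (3.40) p.397 + p.421 + p.423; Balaban1984PropagatorsII, (2.51)–(2.54), (2.60)–(2.61) pp.232–234] -/
theorem hasMaj_P_comp_into_bHZPG (hG : GeoOK (geo9K i)) (hF : Facts347 (geo9K i) R₀ H₀ dF δF α L₀) (hrow : RowSum (toB6 (geo9K i) R₀ H₀) σ c)
    (hβ1 : ∀ f : FBondY i, (geomT i.D).dist (β i.hN i.D i.hk (bI f)) (blkV1 i.hN i.D f) ≤ 1)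
    (hlev : ∀ f : FBondY i, lvl i.hN i.D i.hk (bI f) = (blkV1 i.hN i.D f).1.1)
    (hcf : |i.cf| = (nKT (toKT i) : ℝ)) {U : B.Cfg} (hU : ∀ ν x, UnitaryLike (cfg U ν x))
    {P : Module.End ℝ (XSK κ i → ℝ)} {b₁ : BlockNorm (toB6 (geo9K i) R₀ H₀) F₁} {X : F₁ →ₗ[ℝ] (XSK κ i → ℝ)}
    {CP r CX ρX ρ : ℝ} (hCP : 0 ≤ CP) (hCX : 0 ≤ CX) (hc : 0 ≤ c) (hρ : 0 ≤ ρ) (hρX : ρ ≤ ρX) (hbud : ρ + σ + α * δF ≤ r)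
    (hP : HasMaj (cNormR R₀ H₀ (blkSK i (sIK i bI)) hG.lenle 0) (cNormR R₀ H₀ (blkSK i (sIK i bI)) hG.lenle 0) P
      (fun a a' => CP * Real.exp (-(r * (geo9K i).dist a a'))))
    (hDvP : HasMaj (cNormR R₀ H₀ (blkSK i (sIK i bI)) hG.lenle 0) (cNormR R₀ H₀ (blkBK i bI) hG.lenle 1) (DvcoKH i b B cfg U ∘ₗ P)
      (fun a a' => CP * Real.exp (-(r * (geo9K i).dist a a'))))
    (hX : HasMaj b₁ (cNormR R₀ H₀ (blkSK i (sIK i bI)) hG.lenle (-1)) X (fun a a' => CX * Real.exp (-(ρX * (geo9K i).dist a a')))) :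
    HasMaj b₁ (bHZPG (κ := κ) i b (taxiS i B cfg U) (R := R₀) (H := H₀) w hw0 hw1) (P ∘ₗ X)
      (fun a a' => CTel d ℓ b ρ (CP * (geo9K i).L * CX * c) (CP * (geo9K i).L * CX * c) * Real.exp (-(ρ * (geo9K i).dist a a'))) := by
  have hL0 : 0 ≤ (geo9K i).L := le_trans zero_le_one hF.one_le_L
  have hK : 0 ≤ CP * (geo9K i).L * CX * c := mul_nonneg (mul_nonneg (mul_nonneg hCP hL0) hCX) hc
  -- P and D_UP shifted by −1
  have hP' := hasMaj_shift hG hF (-1 : ℝ) (by norm_num) hCP hP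
  rw [rpow_abs_eq_pow (geo9K i).L (-1) 1 (by norm_num), pow_one, show (0 : ℝ) + -1 = -1 by norm_num] at hP'
  have hD' := hasMaj_shift hG hF (-1 : ℝ) (by norm_num) hCP hDvP
  rw [rpow_abs_eq_pow (geo9K i).L (-1) 1 (by norm_num), pow_one, show (0 : ℝ) + -1 = -1 by norm_num, show (1 : ℝ) + -1 = 0 by norm_num] at hD'
  have hsup := hasMaj_comp_cNormR hG hrow (mul_nonneg hCP hL0) hCX hρ hρX (show ρ + σ ≤ r - α * δF by linarith) hP' hX
  have hgrad := hasMaj_comp_cNormR hG hrow (mul_nonneg hCP hL0) hCX hρ hρX (show ρ + σ ≤ r - α * δF by linarith) hD' hX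
  have hgrad' : HasMaj b₁ (cNormR R₀ H₀ (blkBK i bI) hG.lenle 0) (DvcoKH i b B cfg U ∘ₗ (P ∘ₗ X))
      (fun a a' => CP * (geo9K i).L * CX * c * Real.exp (-(ρ * (geo9K i).dist a a'))) :=
    hgrad.congr fun μ => rfl
  exact hasMaj_into_bHZPG_of_grad i b B cfg hG.lenle w hw0 hw1 hβ1 hlev hρ hcf hU hK hK hsup hgrad'

/-! ## §4 ★★ Through `R = ϱ(I − P)`: the word `RG′∘Z` -/

/-- ★★ **`RG′∘Z` INTO THE CLASS** (R = ϱ(I − P), ϱ the model's scalar, any sign): `RG′Z = G′(ϱZ) − P(G′(ϱZ))`, the first word by §2, the second by §3 after the sup member of `G′(ϱZ)`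
(§2); size `CTel ρ K K + CTel ρ K′ K′` with `K = B₀L|ϱ|C_Zc`, `K′ = C_PL·K·c`.  The scalar is carried by the 𝔠-valued factor `Z` — no homogeneity of the Hölder size is used.
[cite: Balaban1985BackgroundPropagators, p.421 («Theorem 3.1 and the inequality (3.49)») + (3.42) p.397 + (3.49) p.399; Balaban1984PropagatorsII, (2.51)–(2.54), (2.60)–(2.61) pp.232–234] -/
theorem hasMaj_R_Gp_comp_into_bHZPG (hG : GeoOK (geo9K i)) (hF : Facts347 (geo9K i) R₀ H₀ dF δF α L₀) (hrow : RowSum (toB6 (geo9K i) R₀ H₀) σ c)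
    (hβ1 : ∀ f : FBondY i, (geomT i.D).dist (β i.hN i.D i.hk (bI f)) (blkV1 i.hN i.D f) ≤ 1)
    (hlev : ∀ f : FBondY i, lvl i.hN i.D i.hk (bI f) = (blkV1 i.hN i.D f).1.1)
    (hcf : |i.cf| = (nKT (toKT i) : ℝ)) {U : B.Cfg} (hU : ∀ ν x, UnitaryLike (cfg U ν x))
    {Gp P R : Module.End ℝ (XSK κ i → ℝ)} {b₁ : BlockNorm (toB6 (geo9K i) R₀ H₀) F₁} {Z : F₁ →ₗ[ℝ] (XSK κ i → ℝ)}
    {B₀ CP ϱ r CZ ρZ ρ : ℝ} (hB₀ : 0 ≤ B₀) (hCP : 0 ≤ CP) (hCZ : 0 ≤ CZ) (hc : 0 ≤ c) (hρ : 0 ≤ ρ) (hρZ : ρ ≤ ρZ)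
    (hbud : ρ + σ + α * δF ≤ r) (hR : R = ϱ • (LinearMap.id - P))
    (hGp : HasMaj (cNormR R₀ H₀ (blkSK i (sIK i bI)) hG.lenle 0) (cNormR R₀ H₀ (blkSK i (sIK i bI)) hG.lenle (-2)) Gp
      (fun a a' => B₀ * Real.exp (-(r * (geo9K i).dist a a'))))
    (hDvGp : HasMaj (cNormR R₀ H₀ (blkSK i (sIK i bI)) hG.lenle 0) (cNormR R₀ H₀ (blkBK i bI) hG.lenle (-1)) (DvcoKH i b B cfg U ∘ₗ Gp)
      (fun a a' => B₀ * Real.exp (-(r * (geo9K i).dist a a'))))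
    (hP : HasMaj (cNormR R₀ H₀ (blkSK i (sIK i bI)) hG.lenle 0) (cNormR R₀ H₀ (blkSK i (sIK i bI)) hG.lenle 0) P
      (fun a a' => CP * Real.exp (-(r * (geo9K i).dist a a'))))
    (hDvP : HasMaj (cNormR R₀ H₀ (blkSK i (sIK i bI)) hG.lenle 0) (cNormR R₀ H₀ (blkBK i bI) hG.lenle 1) (DvcoKH i b B cfg U ∘ₗ P)
      (fun a a' => CP * Real.exp (-(r * (geo9K i).dist a a'))))
    (hZ : HasMaj b₁ (cNormR R₀ H₀ (blkSK i (sIK i bI)) hG.lenle 1) Z (fun a a' => CZ * Real.exp (-(ρZ * (geo9K i).dist a a')))) :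
    HasMaj b₁ (bHZPG (κ := κ) i b (taxiS i B cfg U) (R := R₀) (H := H₀) w hw0 hw1) (R ∘ₗ Gp ∘ₗ Z)
      (fun a a' => (CTel d ℓ b ρ (B₀ * (geo9K i).L * (|ϱ| * CZ) * c) (B₀ * (geo9K i).L * (|ϱ| * CZ) * c) +
          CTel d ℓ b ρ (CP * (geo9K i).L * (B₀ * (geo9K i).L * (|ϱ| * CZ) * c) * c) (CP * (geo9K i).L * (B₀ * (geo9K i).L * (|ϱ| * CZ) * c) * c)) *
        Real.exp (-(ρ * (geo9K i).dist a a'))) := by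
  have hϱZ : 0 ≤ |ϱ| * CZ := mul_nonneg (abs_nonneg ϱ) hCZ
  -- the scalar on the 𝔠-valued factor
  have hZ' := hasMaj_smul_exp hZ ϱ
  -- first word G′(ϱZ), INTO the class and its sup member
  have h1 := hasMaj_Gp_comp_into_bHZPG i b B cfg w hw0 hw1 hG hF hrow hβ1 hlev hcf hU hB₀ hϱZ hc hρ hρZ hbud hGp hDvGp hZ'
  have h1s := hasMaj_Gp_comp_sup i hG hF hrow hB₀ hϱZ hρ hρZ hbud hGp hZ'
  -- second word P(G′(ϱZ)) INTO the class, at the same rate (ρ ≤ ρ, ρ + σ + αδ_F ≤ r)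
  have h2 := hasMaj_P_comp_into_bHZPG i b B cfg w hw0 hw1 hG hF hrow hβ1 hlev hcf hU hCP
    (mul_nonneg (mul_nonneg (mul_nonneg hB₀ (le_trans zero_le_one hF.one_le_L)) hϱZ) hc) hc hρ le_rfl hbud hP hDvP h1s
  refine (hasMaj_sub_exp h1 h2).congr fun μ => ?_
  simp only [hR, LinearMap.sub_apply, LinearMap.comp_apply, LinearMap.smul_apply, LinearMap.id_apply, map_smul, smul_sub]

/-! ## §5 ★★★ Through `R`: the word `RG′∇\*_U∘Y` from ONE (3.43) member of G′ -/

/-- ★★★ **`RG′∇\*_U∘Y` INTO THE CLASS FROM ONE (3.43) MEMBER.**  `Y : b₁ → 𝔠⁽⁰⁾` on the bond carrier (size `C_Y`, rate `ρ_Y`); G′∇\*_U with its (3.42)₃ sup word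
(`𝔠⁽⁰⁾ → 𝔠_W^{(−1)}`, size `B₀`, rate `r`) AND its (3.43) HÖLDER member `h43 : 𝔠⁽⁰⁾ → bHZPG (taxiS U) w` (size `B₄₃`, rate `r₄₃` — «‖ζG′(U)∇\*_Uλ‖_β ≤ B₀(β)(Lʲη)^{1−β}
e^{−δ₀d}|λ|», the graded weights absorbing `B₀(β)`); P with (3.49)₁,₂ ⟹ `RG′∇\*_UY = G′∇\*_U(ϱY) − P(G′∇\*_U(ϱY)) : b₁ → bHZPG (taxiS U) w`, size `B₄₃|ϱ|C_Yc + CTel ρ K′ K′`,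
`K′ = C_PL·(B₀|ϱ|C_Yc)·c`, rate `ρ` (`0 ≤ ρ ≤ ρ_Y`, `ρ + σ ≤ r₄₃`, `ρ + σ + αδ_F ≤ r`).  The first word is (3.43) composed with `ϱY` ([4] (2.54)); the second is Lipschitz (§3).
This is print's route for the words `RG′D\*…` of Δ′_π, Δ⁽²⁾_π and for `R∇\*_UG₁ = RG′∇\*_U` (p. 421: «Theorem 3.1 and the inequality (3.49)»); the order-zero word
∇G′∇\* is never asked for a sup bound (p. 423). [cite: Balaban1985BackgroundPropagators, Thm 3.1 (3.43) p.398 + (3.42) p.397 + (3.49) p.399 + p.421 + p.423 + (3.152) p.426; Balaban1984PropagatorsII, (2.51)–(2.54), (2.60)–(2.61) pp.232–234] -/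
theorem hasMaj_R_GpDvs_comp_into_bHZPG (hG : GeoOK (geo9K i)) (hF : Facts347 (geo9K i) R₀ H₀ dF δF α L₀) (hrow : RowSum (toB6 (geo9K i) R₀ H₀) σ c)
    (hβ1 : ∀ f : FBondY i, (geomT i.D).dist (β i.hN i.D i.hk (bI f)) (blkV1 i.hN i.D f) ≤ 1)
    (hlev : ∀ f : FBondY i, lvl i.hN i.D i.hk (bI f) = (blkV1 i.hN i.D f).1.1)
    (hcf : |i.cf| = (nKT (toKT i) : ℝ)) {U : B.Cfg} (hU : ∀ ν x, UnitaryLike (cfg U ν x))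
    {Gp P R : Module.End ℝ (XSK κ i → ℝ)} {Dvs : (XBK κ i → ℝ) →ₗ[ℝ] (XSK κ i → ℝ)}
    {b₁ : BlockNorm (toB6 (geo9K i) R₀ H₀) F₁} {Y : F₁ →ₗ[ℝ] (XBK κ i → ℝ)}
    {B₀ CP ϱ r B43 r43 CY ρY ρ : ℝ} (hB₀ : 0 ≤ B₀) (hCP : 0 ≤ CP) (hB43 : 0 ≤ B43) (hCY : 0 ≤ CY) (hc : 0 ≤ c) (hρ : 0 ≤ ρ)
    (hρY : ρ ≤ ρY) (hbud : ρ + σ + α * δF ≤ r) (hbud43 : ρ + σ ≤ r43) (hτ : 0 ≤ α * δF) (hR : R = ϱ • (LinearMap.id - P))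
    (hGpDvs : HasMaj (cNormR R₀ H₀ (blkBK i bI) hG.lenle 0) (cNormR R₀ H₀ (blkSK i (sIK i bI)) hG.lenle (-1)) (Gp ∘ₗ Dvs)
      (fun a a' => B₀ * Real.exp (-(r * (geo9K i).dist a a'))))
    (h43 : HasMaj (cNormR R₀ H₀ (blkBK i bI) hG.lenle 0) (bHZPG (κ := κ) i b (taxiS i B cfg U) (R := R₀) (H := H₀) w hw0 hw1) (Gp ∘ₗ Dvs)
      (fun a a' => B43 * Real.exp (-(r43 * (geo9K i).dist a a'))))
    (hP : HasMaj (cNormR R₀ H₀ (blkSK i (sIK i bI)) hG.lenle 0) (cNormR R₀ H₀ (blkSK i (sIK i bI)) hG.lenle 0) P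
      (fun a a' => CP * Real.exp (-(r * (geo9K i).dist a a'))))
    (hDvP : HasMaj (cNormR R₀ H₀ (blkSK i (sIK i bI)) hG.lenle 0) (cNormR R₀ H₀ (blkBK i bI) hG.lenle 1) (DvcoKH i b B cfg U ∘ₗ P)
      (fun a a' => CP * Real.exp (-(r * (geo9K i).dist a a'))))
    (hY : HasMaj b₁ (cNormR R₀ H₀ (blkBK i bI) hG.lenle 0) Y (fun a a' => CY * Real.exp (-(ρY * (geo9K i).dist a a')))) :
    HasMaj b₁ (bHZPG (κ := κ) i b (taxiS i B cfg U) (R := R₀) (H := H₀) w hw0 hw1) (R ∘ₗ (Gp ∘ₗ Dvs) ∘ₗ Y)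
      (fun a a' => (B43 * (|ϱ| * CY) * c +
          CTel d ℓ b ρ (CP * (geo9K i).L * (B₀ * (|ϱ| * CY) * c) * c) (CP * (geo9K i).L * (B₀ * (|ϱ| * CY) * c) * c)) *
        Real.exp (-(ρ * (geo9K i).dist a a'))) := by
  have hϱY : 0 ≤ |ϱ| * CY := mul_nonneg (abs_nonneg ϱ) hCY
  have hY' := hasMaj_smul_exp hY ϱ
  -- the (3.43) member after ϱY ([4] (2.54) through the state class 𝔠⁽⁰⁾, any target class)
  have h1 := hasMaj_comp_cNormR hG hrow hB43 hϱY hρ hρY hbud43 h43 hY'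
  -- the sup member of G′∇*(ϱY), then P∘(…) INTO the class
  have h1s := hasMaj_comp_cNormR hG hrow hB₀ hϱY hρ hρY (show ρ + σ ≤ r by linarith) hGpDvs hY'
  have h2 := hasMaj_P_comp_into_bHZPG i b B cfg w hw0 hw1 hG hF hrow hβ1 hlev hcf hU hCP (mul_nonneg (mul_nonneg hB₀ hϱY) hc) hc hρ le_rfl hbud
    hP hDvP h1s
  refine (hasMaj_sub_exp h1 h2).congr fun μ => ?_
  simp only [hR, LinearMap.sub_apply, LinearMap.comp_apply, LinearMap.smul_apply, LinearMap.id_apply, map_smul, smul_sub]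

/-- ★★ **THE PRODUCER `RG′∇\*_U` ITSELF** (`Y = I`: the certificate's `rgdH` after (3.152) `R∇\*_UG₁ = RG′∇\*_U`): `RG′∇\*_U : 𝔠⁽⁰⁾ → bHZPG (taxiS U) w` from the (3.42)₃ sup word, ONE (3.43)
member of G′∇\*_U and (3.49)₁,₂, size `B₄₃|ϱ|c + CTel ρ K′ K′`, `K′ = C_PL·B₀|ϱ|c·c`, rate `ρ` (`0 ≤ ρ`, `ρ + σ ≤ r₄₃`, `ρ + σ + αδ_F ≤ r`).
[cite: Balaban1985BackgroundPropagators, Thm 3.13 (3.152) p.426 + Thm 3.1 (3.42)–(3.43) pp.397–398 + (3.49) p.399 + p.421; Balaban1984PropagatorsII, (2.51)–(2.54), (2.60)–(2.61) pp.232–234] -/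
theorem hasMaj_R_GpDvs_into_bHZPG (hG : GeoOK (geo9K i)) (hF : Facts347 (geo9K i) R₀ H₀ dF δF α L₀) (hrow : RowSum (toB6 (geo9K i) R₀ H₀) σ c)
    (hβ1 : ∀ f : FBondY i, (geomT i.D).dist (β i.hN i.D i.hk (bI f)) (blkV1 i.hN i.D f) ≤ 1)
    (hlev : ∀ f : FBondY i, lvl i.hN i.D i.hk (bI f) = (blkV1 i.hN i.D f).1.1)
    (hcf : |i.cf| = (nKT (toKT i) : ℝ)) {U : B.Cfg} (hU : ∀ ν x, UnitaryLike (cfg U ν x))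
    {Gp P R : Module.End ℝ (XSK κ i → ℝ)} {Dvs : (XBK κ i → ℝ) →ₗ[ℝ] (XSK κ i → ℝ)}
    {B₀ CP ϱ r B43 r43 ρ : ℝ} (hB₀ : 0 ≤ B₀) (hCP : 0 ≤ CP) (hB43 : 0 ≤ B43) (hc : 0 ≤ c) (hρ : 0 ≤ ρ)
    (hbud : ρ + σ + α * δF ≤ r) (hbud43 : ρ + σ ≤ r43) (hτ : 0 ≤ α * δF) (hR : R = ϱ • (LinearMap.id - P))
    (hGpDvs : HasMaj (cNormR R₀ H₀ (blkBK i bI) hG.lenle 0) (cNormR R₀ H₀ (blkSK i (sIK i bI)) hG.lenle (-1)) (Gp ∘ₗ Dvs)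
      (fun a a' => B₀ * Real.exp (-(r * (geo9K i).dist a a'))))
    (h43 : HasMaj (cNormR R₀ H₀ (blkBK i bI) hG.lenle 0) (bHZPG (κ := κ) i b (taxiS i B cfg U) (R := R₀) (H := H₀) w hw0 hw1) (Gp ∘ₗ Dvs)
      (fun a a' => B43 * Real.exp (-(r43 * (geo9K i).dist a a'))))
    (hP : HasMaj (cNormR R₀ H₀ (blkSK i (sIK i bI)) hG.lenle 0) (cNormR R₀ H₀ (blkSK i (sIK i bI)) hG.lenle 0) P
      (fun a a' => CP * Real.exp (-(r * (geo9K i).dist a a'))))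
    (hDvP : HasMaj (cNormR R₀ H₀ (blkSK i (sIK i bI)) hG.lenle 0) (cNormR R₀ H₀ (blkBK i bI) hG.lenle 1) (DvcoKH i b B cfg U ∘ₗ P)
      (fun a a' => CP * Real.exp (-(r * (geo9K i).dist a a')))) :
    HasMaj (cNormR R₀ H₀ (blkBK i bI) hG.lenle 0) (bHZPG (κ := κ) i b (taxiS i B cfg U) (R := R₀) (H := H₀) w hw0 hw1) (R ∘ₗ Gp ∘ₗ Dvs)
      (fun a a' => (B43 * (|ϱ| * 1) * c +
          CTel d ℓ b ρ (CP * (geo9K i).L * (B₀ * (|ϱ| * 1) * c) * c) (CP * (geo9K i).L * (B₀ * (|ϱ| * 1) * c) * c)) *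
        Real.exp (-(ρ * (geo9K i).dist a a'))) := by
  have hid := hasMaj_id_cNormR (R₀ := R₀) (H₀ := H₀) i hG (blkBK (κ := κ) i bI) 0 ρ
  have h := hasMaj_R_GpDvs_comp_into_bHZPG i b B cfg w hw0 hw1 hG hF hrow hβ1 hlev hcf hU hB₀ hCP hB43 zero_le_one hc hρ le_rfl hbud hbud43 hτ hR
    hGpDvs h43 hP hDvP hid
  exact h.congr fun μ => rfl

end Producers

end Literature.MathematicalPhysics.QuantumFieldTheory.Balaban1983to89.B9SmoothHolderClassPProducers

end
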